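import Literature.Analysis.Fourier.ChirpSymbolCalculus
import HarnessLib

/-!
# Smooth dilated and translated cut-offs as uniform symbol families

Companion of `Literature/Analysis/Fourier/ChirpSymbolCalculus.lean`: the upper cut-off
`η_T(τ) = S(2 - τ/T)` (`= 1` on `τ ≤ T`, `= 0` on `τ ≥ 2T`) and the lower cut-off
`ρ_H(τ) = S(4(τ - H) - 1)` (`= 0` on `τ ≤ H + 1/4`, `= 1` on `τ ≥ H + 1/2`), built from
Mathlib's `Real.smoothTransition` `S`, are uniform symbol families of order `0`
(`SymBnd.etaCut`, uniformly in `T ≥ 1`; `SymBnd.rhoCut`). Standard (Stein, *Harmonic Analysis*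
(1993), Ch. VIII §1.2, dyadic cut-offs). Everything is proved; no named facts.
-/

noncomputable section

open Set Filter
open scoped Topology ContDiff

namespace Literature.Analysis.Fourier

variable {ι : Type*}

/-! ## Smooth cut-offs -/

/-- The iterated derivatives of `Real.smoothTransition` of positive order vanish off `[0, 1]`
and are bounded. [folklore] -/
theorem exists_bound_iteratedDeriv_smoothTransition (r : ℕ) (hr : 1 ≤ r) :
    ∃ M : ℝ, 0 ≤ M ∧ (∀ x, |iteratedDeriv r Real.smoothTransition x| ≤ M) ∧
      ∀ x, (x < 0 ∨ 1 < x) → iteratedDeriv r Real.smoothTransition x = 0 := by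
  have hzero : ∀ x, (x < 0 ∨ 1 < x) → iteratedDeriv r Real.smoothTransition x = 0 := by
    intro x hx
    rcases hx with hx | hx
    · have heq : EqOn Real.smoothTransition (fun _ => (0 : ℝ)) (Iio 0) :=
        fun y hy => Real.smoothTransition.zero_of_nonpos (le_of_lt hy)
      rw [heq.iteratedDeriv_of_isOpen isOpen_Iio r hx, iteratedDeriv_const]
      rcases r with _ | r
      · omega
      · simp
    · have heq : EqOn Real.smoothTransition (fun _ => (1 : ℝ)) (Ioi 1) :=
        fun y hy => Real.smoothTransition.one_of_one_le (le_of_lt hy)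
      rw [heq.iteratedDeriv_of_isOpen isOpen_Ioi r hx, iteratedDeriv_const]
      rcases r with _ | r
      · omega
      · simp
  have hcont : Continuous (iteratedDeriv r Real.smoothTransition) :=
    Real.smoothTransition.contDiff.continuous_iteratedDeriv r (mod_cast le_top)
  obtain ⟨M, hM⟩ := isCompact_Icc.exists_bound_of_continuousOn (hcont.continuousOn (s := Icc 0 1))
  refine ⟨max M 0, le_max_right _ _, fun x => ?_, hzero⟩
  by_cases hx : x ∈ Icc (0 : ℝ) 1
  · exact (le_max_left _ _).trans' (by simpa using hM x hx)
  · rw [mem_Icc, not_and_or, not_le, not_le] at hx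
    rw [hzero x hx, abs_zero]
    exact le_max_right _ _

/-- The upper cut-off `η_T(τ) = smoothTransition (2 - τ/T)`: equal to `1` for `τ ≤ T`, to `0`
for `τ ≥ 2T`. [folklore] -/
def etaCut (T τ : ℝ) : ℝ := Real.smoothTransition (2 + (-T⁻¹) * τ)

/-- The lower cut-off `ρ_H(τ) = smoothTransition (4(τ - H) - 1)`: equal to `0` for `τ ≤ H + 1/4`,
to `1` for `τ ≥ H + 1/2`. [folklore] -/
def rhoCut (H τ : ℝ) : ℝ := Real.smoothTransition ((-4 * H - 1) + 4 * τ)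

/-- `η_T = 1` on `τ ≤ T` (`T > 0`). [folklore] -/
theorem etaCut_eq_one {T τ : ℝ} (hT : 0 < T) (h : τ ≤ T) : etaCut T τ = 1 := by
  apply Real.smoothTransition.one_of_one_le
  have : T⁻¹ * τ ≤ 1 := by rw [inv_mul_le_iff₀ hT]; simpa using h
  linarith

/-- `η_T = 0` on `τ ≥ 2T` (`T > 0`). [folklore] -/
theorem etaCut_eq_zero {T τ : ℝ} (hT : 0 < T) (h : 2 * T ≤ τ) : etaCut T τ = 0 := by
  apply Real.smoothTransition.zero_of_nonpos
  have : 2 ≤ T⁻¹ * τ := by rw [le_inv_mul_iff₀ hT]; linarith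
  linarith

/-- `0 ≤ η_T ≤ 1`. [folklore] -/
theorem abs_etaCut_le (T τ : ℝ) : |etaCut T τ| ≤ 1 := by
  unfold etaCut
  rw [abs_of_nonneg (Real.smoothTransition.nonneg _)]
  exact Real.smoothTransition.le_one _

/-- `ρ_H = 0` on `τ ≤ H + 1/4`. [folklore] -/
theorem rhoCut_eq_zero {H τ : ℝ} (h : τ ≤ H + 1 / 4) : rhoCut H τ = 0 :=
  Real.smoothTransition.zero_of_nonpos (by linarith)

/-- `ρ_H = 1` on `τ ≥ H + 1/2`. [folklore] -/
theorem rhoCut_eq_one {H τ : ℝ} (h : H + 1 / 2 ≤ τ) : rhoCut H τ = 1 :=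
  Real.smoothTransition.one_of_one_le (by linarith)

/-- `0 ≤ ρ_H ≤ 1`. [folklore] -/
theorem abs_rhoCut_le (H τ : ℝ) : |rhoCut H τ| ≤ 1 := by
  unfold rhoCut
  rw [abs_of_nonneg (Real.smoothTransition.nonneg _)]
  exact Real.smoothTransition.le_one _

/-- `η_T` is smooth. [folklore] -/
theorem contDiff_etaCut (T : ℝ) : ContDiff ℝ ∞ (etaCut T) :=
  Real.smoothTransition.contDiff.comp (contDiff_const.add (contDiff_const.mul contDiff_id))

/-- `ρ_H` is smooth. [folklore] -/
theorem contDiff_rhoCut (H : ℝ) : ContDiff ℝ ∞ (rhoCut H) :=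
  Real.smoothTransition.contDiff.comp (contDiff_const.add (contDiff_const.mul contDiff_id))

/-- Chain rule for an affine substitution: `(S(c₀ + c τ))^{(r)} = c^r S^{(r)}(c₀ + c τ)`. [folklore] -/
theorem iteratedDeriv_smoothTransition_affine (c₀ c : ℝ) (r : ℕ) (τ : ℝ) :
    iteratedDeriv r (fun τ => Real.smoothTransition (c₀ + c * τ)) τ =
      c ^ r * iteratedDeriv r Real.smoothTransition (c₀ + c * τ) := by
  have hcd : ContDiff ℝ r (fun y : ℝ => Real.smoothTransition (c₀ + y)) :=
    (Real.smoothTransition.contDiff (n := r)).comp (contDiff_const.add contDiff_id)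
  have h1 := iteratedDeriv_comp_const_mul hcd c
  have h2 := iteratedDeriv_comp_const_add r Real.smoothTransition c₀
  have := congrFun h1 τ
  beta_reduce at this
  rw [this, h2]

/-- **The dilated cut-offs `η_{T_i}` form a uniform symbol family of order `0`** (for `T_i ≥ 1`):
`|η_T^{(r)}(τ)| ≤ 2^r ‖S^{(r)}‖_∞ τ^{-r}`, because `η_T^{(r)}` lives on `[T, 2T]`. [folklore] -/
theorem SymBnd.etaCut {S : Set ι} {H : ℝ} (hH : 1 ≤ H) (T : ι → ℝ) (hT : ∀ i ∈ S, 1 ≤ T i)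
    (R : ℕ) : SymBnd S H 0 R (fun i τ => etaCut (T i) τ) := by
  intro r _
  rcases Nat.eq_zero_or_pos r with rfl | hr
  · refine ⟨1, zero_le_one, 0, fun i hi τ hτ => ?_⟩
    simpa using abs_etaCut_le (T i) τ
  · obtain ⟨M, hM0, hM, hz⟩ := exists_bound_iteratedDeriv_smoothTransition r hr
    refine ⟨2 ^ r * M, by positivity, 0, fun i hi τ hτ => ?_⟩
    have hτ0 : 0 < τ := by linarith
    have hTi : 0 < T i := by linarith [hT i hi]
    unfold Literature.Analysis.Fourier.etaCut
    rw [iteratedDeriv_smoothTransition_affine, pow_zero, mul_one, abs_mul, abs_pow, abs_neg,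
      abs_inv, abs_of_pos hTi]
    by_cases hsupp : (2 + -(T i)⁻¹ * τ < 0 ∨ 1 < 2 + -(T i)⁻¹ * τ)
    · rw [hz _ hsupp, abs_zero, mul_zero]
      have : 0 ≤ τ ^ ((0 : ℝ) - r) := Real.rpow_nonneg hτ0.le _
      positivity
    · push Not at hsupp
      obtain ⟨h1, h2⟩ := hsupp
      -- `T ≤ τ ≤ 2T`, so `T⁻¹ ≤ 2 τ⁻¹`
      have hTτ : τ ≤ 2 * T i := by
        have : (T i)⁻¹ * τ ≤ 2 := by linarith
        rw [inv_mul_le_iff₀ hTi] at this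
        linarith
      have hinv : (T i)⁻¹ ≤ 2 * τ⁻¹ := by
        rw [inv_le_comm₀ hTi (by positivity), mul_inv, inv_inv]
        linarith
      have hpow : (T i)⁻¹ ^ r ≤ (2 * τ⁻¹) ^ r :=
        pow_le_pow_left₀ (inv_nonneg.mpr hTi.le) hinv r
      calc (T i)⁻¹ ^ r * |iteratedDeriv r Real.smoothTransition (2 + -(T i)⁻¹ * τ)|
          ≤ (2 * τ⁻¹) ^ r * M := mul_le_mul hpow (hM _) (abs_nonneg _) (by positivity)
        _ = 2 ^ r * M * τ ^ ((0:ℝ) - r) := by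
          rw [zero_sub, Real.rpow_neg hτ0.le, Real.rpow_natCast, mul_pow, inv_pow]
          ring

/-- `η` is a smooth family (everywhere, in particular on `(H, ∞)`). [folklore] -/
theorem SmoothFam.etaCut (S : Set ι) (H : ℝ) (T : ι → ℝ) :
    SmoothFam S H (fun i τ => Literature.Analysis.Fourier.etaCut (T i) τ) :=
  fun i _ => (contDiff_etaCut (T i)).contDiffOn

/-- **The lower cut-off `ρ_H` is a uniform (constant) symbol family of order `0`**:
`|ρ_H^{(r)}(τ)| ≤ 4^r ‖S^{(r)}‖_∞ (H + 1/2)^r τ^{-r}`, because `ρ_H^{(r)}` lives on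
`[H + 1/4, H + 1/2]`. [folklore] -/
theorem SymBnd.rhoCut (S : Set ι) {H : ℝ} (hH : 1 ≤ H) (R : ℕ) :
    SymBnd S H 0 R (fun _ τ => rhoCut H τ) := by
  intro r _
  rcases Nat.eq_zero_or_pos r with rfl | hr
  · refine ⟨1, zero_le_one, 0, fun i hi τ hτ => ?_⟩
    simpa using abs_rhoCut_le H τ
  · obtain ⟨M, hM0, hM, hz⟩ := exists_bound_iteratedDeriv_smoothTransition r hr
    refine ⟨4 ^ r * M * (H + 1 / 2) ^ r, by positivity, 0, fun i hi τ hτ => ?_⟩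
    have hτ0 : 0 < τ := by linarith
    unfold Literature.Analysis.Fourier.rhoCut
    rw [iteratedDeriv_smoothTransition_affine, pow_zero, mul_one, abs_mul, abs_pow,
      show |(4:ℝ)| = 4 by norm_num]
    by_cases hsupp : ((-4 * H - 1) + 4 * τ < 0 ∨ 1 < (-4 * H - 1) + 4 * τ)
    · rw [hz _ hsupp, abs_zero, mul_zero]
      have : 0 ≤ τ ^ ((0 : ℝ) - r) := Real.rpow_nonneg hτ0.le _
      positivity
    · push Not at hsupp
      obtain ⟨h1, h2⟩ := hsupp
      have hτle : τ ≤ H + 1 / 2 := by linarith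
      -- `1 ≤ (H + 1/2) τ⁻¹`
      have hone : (1 : ℝ) ≤ ((H + 1 / 2) * τ⁻¹) ^ r := by
        apply one_le_pow₀
        rw [← div_eq_mul_inv, le_div_iff₀ hτ0]
        linarith
      calc (4 : ℝ) ^ r * |iteratedDeriv r Real.smoothTransition ((-4 * H - 1) + 4 * τ)|
          ≤ 4 ^ r * M := mul_le_mul_of_nonneg_left (hM _) (by positivity)
        _ ≤ 4 ^ r * M * ((H + 1 / 2) * τ⁻¹) ^ r := le_mul_of_one_le_right (by positivity) hone
        _ = 4 ^ r * M * (H + 1 / 2) ^ r * τ ^ ((0:ℝ) - r) := by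
          rw [zero_sub, Real.rpow_neg hτ0.le, Real.rpow_natCast, mul_pow, inv_pow]
          ring

/-- `ρ_H` is a smooth family. [folklore] -/
theorem SmoothFam.rhoCut (S : Set ι) (H : ℝ) :
    SmoothFam S H (fun (_ : ι) τ => Literature.Analysis.Fourier.rhoCut H τ) :=
  fun _ _ => (contDiff_rhoCut H).contDiffOn

end Literature.Analysis.Fourier
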